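import Summits.ResolutionOfSingularities.ResolutionOfSingularities.Theorems.MarkedTransferCampaignW13Bypass
import Mathlib.Algebra.MvPolynomial.Variables
import HarnessLib

/-!
# [OURS · L1 W1.3] The CANONICAL chain class `𝒞_can` + the rung-1 CONTENT Prop (A≠B #7 v5 resolution), and the F7′
# CONSUMER-TABLE FEEDS for the R-flat bypass as typed OURS signatures (hand-overs res-L1-s13-pv-1 2026-08-27T01:28:17Z +
# F7PRIME-TABLE-W13.md b8dcd41311aad870, standing in for the unseated res-L1-s13-plan-1; typer res-L1-type-o2)

LADDER-RESOLUTION rung L (rescue), cell `res-hironaka`, RESCUE-SEED slot W1.3 (architecture bypass, reading R-flat). director-resolution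
2026-08-27T01:05:24Z (1), words of record: «W1.3 R-flat passes F6/F7 only by VACATING the slot (℘nega := ⊥ by design); it is a
REPLACEMENT iff F7′ closes = every F7/F5 consumer re-fed from Cot_flat: (110) `Eq110` · Th 15.9's chain `Thm15_9*` · Rem 5.4 `Rem5_4` ·
Th 7.11 (2); … CAMPAIGN.md names the SUBSTITUTE FEED per consumer (4 rows: the statement each consumer needs from Cot_flat, as an OURS
signature or «cannot be re-fed because …») … that table is W1.3's next rung and its kill line». §0 types the CLASS the slot prover
handed over (STATUS 2026-08-27T01:28:17Z, draft `L/res-L1-s13-pv-1/DraftCanonicalClass.lean`): `Campaign.IsCanonicalChain` (= `𝒞_can`, chart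
level on `K[x_σ]`) and the rung-1 CONTENT Prop `Campaign.CampaignW13RFlatCanonicalPos` («every canonical chain keeps its tail under
R-flat», OPEN — the honest target after the census 2026-08-27T01:16:59Z killed the §9.7-recipe class, p481686) — this is the «content
Prop» lane B asked for on OURS-DESK #7 v5 (res-L1-ref-b3 PARTIAL 01:17:45Z option (i); A≠B listed for res-adj-8), in the ℘-form the
slot prover declares honest (the `⊆ 𝒞_Diff` form is FALSE in general, see the docstring). §1 types the table's CLASS-INDEPENDENT
signatures (rows 2(a), 3, 4) over the W1.3 vocabulary of `MarkedTransferCampaignW13Bypass.lean` (v5 p480169: `bypassCotRFlat`,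
`pAlgPiece`, …) and rows 003 / 015 — rows 2(a) and 4 were CLOSED IN KERNEL by res-L1-s13-pv-1 the same hour (p482662
`Theorems/MarkedTransferCampaignW13BypassF7Prime.lean`: `bypassCotRFlat_le_radical_of_U67_2`, `pAlgebraicRing_mem_of_isIntegral`), the
Props here are the NAMES the table cites; §2 the CLASS-DEPENDENT rows 1 / 2(b) as schemas. Host `--supports
stmt-ResolutionOfSingularities-15522` like every G1 OURS file; namespace `…Theorems.Campaign`. A separate file (not v6 of the 378-line
W13 file) to respect the 400-line rule and «one topic per file».

HONEST FRAMING. Nothing here is a statement of H. Hironaka's manuscript *Resolution of singularities in positive characteristics*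
(2017-03-23, [Hironaka2017], lit key `paper:url-3343fd9e678b`): Th 15.9 p.79, Rem 5.4 p.26, Th 7.11 (2) p.38–39, the §13.1 clause
U67_2 p.67 are CANDIDATES [claim: Hironaka2017, status: under-review] entering only as typed carriers / hypotheses; the decls below are
OURS statements about OUR bypass objects, STATED NOT CLAIMED (res-L1-s13-pv-1 proves or refutes them). Caveat of record: any R-flat
finding leaves L-G4 / (127) open (`KangarooShadeIncrease.Hauser2003_kangarooShadeIncrease`). AI typing is weaker than expert review;
nothing here is progress on resolution of singularities in positive characteristic.
-/

noncomputable section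

set_option linter.dupNamespace false -- mandated namespace of this single-conjunct summit

namespace Summit.ResolutionOfSingularities.ResolutionOfSingularities.Theorems.Campaign

open Literature.AlgebraicGeometry.Hironaka2017
open Literature.AlgebraicGeometry.Hironaka2017.S11CoordFree (BlSub)

universe v

variable {O : Type v} [CommRing O] {p : ℕ} [Fact p.Prime] [CharP O p] {ℓ : ℕ}

/-! ## §0 The canonical chain class `𝒞_can` and the rung-1 CONTENT Prop (hand-over res-L1-s13-pv-1 2026-08-27T01:28:17Z, verbatim) -/

section CanonicalClass

open MvPolynomial
open Literature.AlgebraicGeometry.Hironaka2017.S09LLUED (LLChainData)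

/-- [OURS · L1 W1.3, rung 1 — THE CLASS `𝒞_can`] replaces the role of «the LL-chain headed by `g`» of Eq. (83)/(84) p.55 (row 061
`S09LLUED.LLChainData.IsLLChainAt(_ours)` with `⊟ :=` the §9.7 `H♭`-products) by the JUNK-FREE knock-out: chain data on the chart ring
`K[x_σ]` headed by `g(0) = x_y^q + ε` (`q = p^e`, `ε` free of the tail variable `x_y` — the `g`-cleaned head of Eq. (82)) whose tail is
the CANONICAL one, `x_y + r` with `r` free of `x_y` and `r^q` the `q`-th-power part of `ε`, i.e. the total knock-out
`ε − r^q = g(0) − tail^q` has NO monomial all of whose exponents are divisible by `q`. WHY: res-L1-s13-pv-1's census (STATUS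
2026-08-27T01:16:59Z, kit j263239/j263697; kernel p481686 `N_not_rFlatTailPow`) — the printed `H♭` recipe's extra `q`-th-power terms are
exactly what breaks POS (73 of 12 255 heads), while the canonical tail has 0 counterexamples. Hand-over signature verbatim
(`L/res-L1-s13-pv-1/DraftCanonicalClass.lean`). NOT a statement of the manuscript (no printed item defines this class); OURS.
VACUITY: inhabited (every head `x_y^q + ε` with `ε` free of `x_y` has exactly one canonical datum per level `e`). [folklore] -/
def IsCanonicalChain (p : ℕ) (K : Type v) [CommRing K] {σ : Type} (y : σ) (d : LLChainData (MvPolynomial σ K)) : Prop :=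
  ∃ ε r : MvPolynomial σ K, y ∉ ε.vars ∧ y ∉ r.vars ∧
    d.g 0 = X y ^ (p ^ d.e) + ε ∧ d.tail = X y + r ∧
      ∀ m ∈ (ε - r ^ (p ^ d.e)).support, ∃ i, ¬ (p ^ d.e ∣ m i)

/-- [OURS · L1 W1.3, rung 1 — THE CONTENT PROP on `𝒞_can` (A≠B #7 v5: lane B's «content Prop», option (i) of res-L1-ref-b3
2026-08-27T01:17:45Z, in the form the slot prover declares honest)] replaces the role — for the R-flat tails module — of the membership
Th 14.2 Eq. (108) p.69 L7–L8 draws from the printed `℘nega` knock-outs, ON THE CANONICAL CLASS: every canonical chain datum keeps its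
tail under R-flat for the hypersurface model `Ě = ((g(0)), q)`, `q = p^{d.e}`, `℘` BOUND (algebraic): `RFlatTailPow p K (span {g(0)}) q d`
(v4). OPEN, NOT claimed: census j263239/j263697 — 0 counterexamples among 12 255 heads; pass 3 j264545 (canonical knock-out on all
heads) running at filing time; KILL LINE for W1.3 rows 1/2(b) of the F7′ table: one arc-certified canonical chain with
`tail^q ∉ ℘_alg(Ě,1)`. The STRONGER `⊆ 𝒞_Diff` form («`∃ j < q, g(0) − tail^q ∈ Diff^{(j)}_K(span {g(0)})`») is FALSE in general
(s13-pv-1: TEST1 fails on e.g. `y²+x₁³x₂³+x₁⁵+x₂⁵` locally; only the integral closure holds such heads) and is therefore NOT typed.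
NOT a statement of the manuscript. VACUITY: not trivially true (the class is inhabited and POS fails on nearby non-canonical data,
p481686) nor trivially false (holds on A/B/C/D/R2/E2, p478130/p479454). [folklore] -/
def CampaignW13RFlatCanonicalPos (p : ℕ) (K : Type v) [CommRing K] {σ : Type} (y : σ) : Prop :=
  ∀ d : LLChainData (MvPolynomial σ K), IsCanonicalChain p K y d →
    RFlatTailPow p K (Ideal.span {d.g 0}) (p ^ d.e) d

/-- Unfolding (by `Iff.rfl`): the content Prop is `RFlatTailPowOn` (v4) at the hypersurface model read chain-wise — for the lanes,
the exact relation to the v4 schema (here `J` and `b` depend on the datum, so it is not literally one `RFlatTailPowOn`). [folklore] -/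
theorem campaignW13RFlatCanonicalPos_iff (p : ℕ) (K : Type v) [CommRing K] {σ : Type} (y : σ) :
    CampaignW13RFlatCanonicalPos p K y ↔
      ∀ d : LLChainData (MvPolynomial σ K), IsCanonicalChain p K y d →
        d.tail ^ (p ^ d.e) ∈ pAlgPiece K (Ideal.span {d.g 0}) (p ^ d.e) 1 :=
  Iff.rfl

end CanonicalClass

/-! ## §1 F7′ class-independent rows 2(a) / 3 / 4 -/

section F7PrimeFeeds

variable (K : Type v) [CommRing K] [Algebra K O]

/-- [OURS · L1 W1.3, F7′ row 2(a)] replaces the role — for the R-flat bypass — of Th 15.9's first step p.79 L16–L19 («`𝔏♯(ξ) = 0 ⇒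
𝔏♭(ξ) = 0 ⇒ Cot(ξ) = 0` at every `ξ ∈ Sing(Ě)`», row 090/091 `S15ARSchemes.Thm15_9*`; under the printed collapse `Cot = O_ξ` and the
step FAILS, R08(α) / `Def13p2Carrier.lean :: Cot_eq_top_of_degree_full`) by the SUBSTITUTE FEED «`Cot_flat ⊆ √I(Sing)`»: GIVEN the §13.1
clause U67_2 p.67 L15 («`𝔏_0(∞) ⊂ I(Sing) Bl(Z)`», row 015 `S13GLUEDDiagram.U67_2 tau0 L0inf ISing`, a CANDIDATE consumed as a hypothesis),
every element of the R-flat cotangent module `bypassCotRFlat e L0inf P1` (v2; an additive subgroup, row 015's `Cot` shape) lies in the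
radical of `I(Sing)`. Set inclusion because `Cot` is typed as an `AddSubgroup`. Drafted by res-L1-s13-pv-1 (table row 2(a)); NOT a
statement of the manuscript; stated, not claimed (s13 closes it: `Cot_flat^q ⊆ 𝔗♭_flat ⊆ ∥𝔏_0(∞)∥ ⊆ I(Sing)` via `bypassTFlatRFlat_le` +
row 015's `Cot_subset_radical` pattern). VACUITY: false only if some `φ` with `φ^q ∈ ∥𝔏_0(∞)∥` escapes `√I(Sing)` while `∥𝔏_0(∞)∥ ⊆
I(Sing)` — i.e. never; the content is the bookkeeping, as for its printed counterpart. [folklore] -/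
def CampaignW13CotFlatVanishes (e : ℕ) (tau0 : BlSub O p ℓ → BlSub O p ℓ) (L0inf : BlSub O p ℓ) (ISing P1 : Ideal O) : Prop :=
  S13GLUEDDiagram.U67_2 tau0 L0inf ISing →
    ((bypassCotRFlat e L0inf P1 : AddSubgroup O) : Set O) ⊆ (ISing.radical : Set O)

/-- [OURS · L1 W1.3, F7′ row 3 — THE BYPASS CANDIDATE AS A ℤ-FAMILY] replaces the role of Rem 5.4's `ℤ`-graded `℘̃(E,i)`
(p.26 L18–L21, row 008b `Rem5_4`; with Lem 5.8/5.9, Th 7.11 (1): the graded, multiplicative, Diff-closed algebra the modules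
`𝔏_{e−i}(j)` live in, Prop 11.7 / Th 12.7) for the R-flat bypass: positive degrees = the BOUND algebraic `℘(Ě,i)` (`pAlgPiece K J b i`),
degree `0` = `O` (as `℘̃(E,0) ⊇ O`, Rem 5.4), NEGATIVE degrees = `⊥` — THE SLOT IS VACATED (director 2026-08-27T01:05:24Z (1) words
of record «℘nega := ⊥ by design»). This is also W1.3's VALUE for the ℘nega-INTERFACE's data field at one ring
(`Campaign.PnegaInterfaceV2`, file `…G1PnegaInterfaceV2.lean`: `tilde P i := (pTildeFlat …).toAddSubgroup` with `P := pAlgPiece K J b`),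
so W1.3's F-cells cite a decl. Draft res-L1-s13-pv-1 table row 3 put `⊤` in all degrees `≤ 0`; typed with `⊥` below degree `0`
because `⊤` there is the COLLAPSED value (fails F7 by fiat) and not the bypass — typer's reading, flagged on STATUS 2026-08-27T01:3xZ,
s13 may supersede. NOT a statement of the manuscript. [folklore] -/
def pTildeFlat (J : Ideal O) (b : ℕ) (i : ℤ) : Ideal O :=
  if 0 < i then pAlgPiece K J b i.toNat else if i = 0 then ⊤ else ⊥

/-- Unfolding: positive degrees of `pTildeFlat` are the bound `℘`-pieces. [folklore] -/
theorem pTildeFlat_of_pos (J : Ideal O) (b : ℕ) {i : ℤ} (hi : 0 < i) :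
    pTildeFlat K J b i = pAlgPiece K J b i.toNat := by
  simp [pTildeFlat, hi]

/-- Unfolding: degree `0` of `pTildeFlat` is everything. [folklore] -/
theorem pTildeFlat_zero (J : Ideal O) (b : ℕ) : pTildeFlat K J b 0 = ⊤ := by
  simp [pTildeFlat]

/-- Unfolding: NEGATIVE degrees of `pTildeFlat` are `⊥` — the slot is vacated. [folklore] -/
theorem pTildeFlat_of_neg (J : Ideal O) (b : ℕ) {i : ℤ} (hi : i < 0) : pTildeFlat K J b i = ⊥ := by
  simp [pTildeFlat, not_lt.mpr hi.le, hi.ne]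

/-- [OURS · L1 W1.3, F7′ row 4] replaces the role — for the R-flat bypass, degrees `≥ 0` — of Th 7.11 (2) p.38 L30 – p.39 L8
(«`℘̃(E)` is integrally closed in `Bl(Z)`», row 041 `S07Permissible.Thm7_11_2`; consumer of Lem 7.10 / (62), feeds F5 and Th 7.12):
the BOUND algebraic characteristic algebra `S04CharAlgebra.pAlgebraicRing K O J b ⊆ O[X]` (row 003 U17_2: by DEFINITION the integral
closure of the Diff-generated subalgebra) is integrally closed in `O[X]`. TRUE BY CONSTRUCTION (Mathlib: an integral closure is
integrally closed in the ambient algebra) — s13 closes it in one short lemma; typed so that the F7′ table's row 4 cites a decl. The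
NEGATIVE half of Th 7.11 (2) has no object under the bypass (vacated; its printed use Th 7.12 / R34 is moot there — table row 4).
NOT a statement of the manuscript. VACUITY: none (a genuine, if definitional, property). [folklore] -/
def CampaignW13PTildeFlatIntClosed (J : Ideal O) (b : ℕ) : Prop :=
  ∀ x : Polynomial O, IsIntegral (S04CharAlgebra.pAlgebraicRing K O J b) x → x ∈ S04CharAlgebra.pAlgebraicRing K O J b

end F7PrimeFeeds

/-! ## §2 Class-dependent rows 1 / 2(b) as SCHEMAS in the chain class `𝒞` / the cotangent data (closed instances at `𝒞_can` follow
on the slot prover's hand-over of its definition) -/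

section F7PrimeSchemas

open Literature.AlgebraicGeometry.Hironaka2017.S09LLUED (LLChainData)

variable (p) (K : Type v) [CommRing K] [Algebra K O]

/-- [OURS · L1 W1.3, F7′ row 1 — SCHEMA in the chain class] replaces the role — for the R-flat bypass — of what Th 14.4 Eq. (110)
p.69 L29–L31 (row 081 `S14LocalGlobal.Eq110`: `𝔏₀(∞) = 𝔏₀(∞)∩ρ^e(Bl(Z,1)) + 𝔏₀(∞)∩ρ^r(℘nega)`) supplies downstream, namely the
negative-degree HOME of the knock-outs («`h(i) ∈ ℘nega(Ě)`», (129) p.84 L37) that puts `g − y(e)^q` into `𝔗♭` and hence `y(e)` into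
`Cot` (Th 14.2 (108)): the SUBSTITUTE FEED «the total knock-out lives in `℘(Ě,1)`» for every chain of the class `𝒞` —
`∀ d, 𝒞 d → g(0) ∈ J ∧ g(0) − y(e)^q ∈ ℘(Ě,1)` (bound, `pAlgPiece K J b 1`); then `Cot_flat ∋ y(e) ⟺ (107)_{i=e}` by
`tail_mem_bypassCotRFlatAlg_iff` (v4). Table row 1 (res-L1-s13-pv-1): TRUE at `𝒞 = 𝒞_Diff` (p482051), FALSE at the §9.7-recipe class
(p481686, census 73 heads), OPEN at `𝒞_can`. A SCHEMA (class = parameter); the campaign's closed instance names the class. NOT a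
statement of the manuscript. VACUITY: trivially true for an empty class. [folklore] -/
def CampaignW13Eq110Sub (J : Ideal O) (b : ℕ) (𝒞 : LLChainData O → Prop) : Prop :=
  ∀ d : LLChainData O, 𝒞 d → d.g 0 ∈ J ∧ d.g 0 - d.tail ^ (p ^ d.e) ∈ pAlgPiece K J b 1

omit [Fact p.Prime] [CharP O p] in
/-- Pure logic: the row-1 feed on a class implies POS on that class (`RFlatTailPowOn`, v4) — `y(e)^q = g(0) − (g(0) − y(e)^q)` with
both terms in the ideal `℘(Ě,1)` GIVEN `J ⊆ ℘(Ě,1)` (true for `b ≥ 1`, s13's `Campaign.W13.le_pAlgPiece_self`-pattern; a hypothesis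
here to keep this file import-light). [folklore] -/
theorem rFlatTailPowOn_of_eq110Sub {J : Ideal O} {b : ℕ} {𝒞 : LLChainData O → Prop} (hJ : J ≤ pAlgPiece K J b 1)
    (h : CampaignW13Eq110Sub p K J b 𝒞) : RFlatTailPowOn p K J b 𝒞 := by
  intro d hd
  obtain ⟨hg, hk⟩ := h d hd
  have : d.tail ^ (p ^ d.e) = d.g 0 - (d.g 0 - d.tail ^ (p ^ d.e)) := by ring
  rw [RFlatTailPow, this]
  exact Ideal.sub_mem _ (hJ hg) hk

variable {p K}

/-- [OURS · L1 W1.3, F7′ row 2(b) — SCHEMA in the cotangent data] replaces the role — for the R-flat bypass — of Def 15.8 (2)–(3)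
/ Eq. (125) p.78 L8–L22 (rows 090/091 `S15ARSchemes.Def15_8`, `Eq125`: «enough cotangential generators: rank Cot/(Cot ∩ 𝔪²) = rank
𝔳(Ě)`) by the SUBSTITUTE FEED «every cotangent vector of `𝔳(Ě)_ξ` has a representative in `Cot_flat` modulo `𝔪_ξ²`»: at one
stalk `O` with maximal ideal `𝔪`, for every `v` in the set `V` of tail representatives (`𝔳(Ě)_ξ`, a PARAMETER — row 006 /
Th 9.18 (2) reads tails mod `𝔪²`) there is `φ ∈ bypassCotRFlat e L0inf P1` with `φ − v ∈ 𝔪²`. Table row 2(b) (res-L1-s13-pv-1):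
fed by (107) ∧ POS for ONE chain per cotangent vector (the canonical chain; recipe and canonical tails agree mod `𝔪²`); RE-FED on
B/C/D/A/R2/E2, OPEN in general. A SCHEMA (`V`, `𝔪` parameters). NOT a statement of the manuscript. VACUITY: trivial for `V = ∅`
or `𝔪 = ⊤`; instantiate at `𝔪 = 𝔪_ξ`, `V =` the tails of the chains headed at `ξ`. [folklore] -/
def CampaignW13Eq125Flat (e : ℕ) (L0inf : BlSub O p ℓ) (P1 𝔪 : Ideal O) (V : Set O) : Prop :=
  ∀ v ∈ V, ∃ φ : O, φ ∈ bypassCotRFlat e L0inf P1 ∧ φ - v ∈ 𝔪 ^ 2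

end F7PrimeSchemas

end Summit.ResolutionOfSingularities.ResolutionOfSingularities.Theorems.Campaign

end
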